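import Summits.QuantumFields.YangMills.Theorems.BalabanUVNodesN15SiteCurvedOperatorEntries
import HarnessLib

/-!
# Route «BalabanUVNodes», cluster K4 «SpineRates» — node N15 = NE2: THE SITE LAYER WITH THE BACKGROUND LIVE IN THE TwoGrid ENTRY CURRENCY, XXXVIII — THE LAPLACIAN LETTERS OF
# THE CURVED KING FAMILY: `N²Δ ⊗ 1` of King's full `A = 0` propagator `⊗ 1` on both grids — the dictionary with dag-n15-e's Σ-a object `kingLapOp`, the fine rows and the two-grid
# η-defect on the CLOSED mass range `0 ≤ m² ≤ m₀²` (massless endpoint included), read on part XXXIII's coloured carriers (the undressed half of entry 3 of part XXXVI)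

Cell `pub-ymgap`, WIDTH SEAT `pub-ymgap-dag-n15-w1` (generation 5; director-ym №197 ∕ HUMAN RULING D-0149, №219 (1); chair R455 (A) ∕ R461; dag-lead KEY MAP v2 INBOX l.35754;
the located sequel (o1) of dag-n15-e g15 INBOX l.39322 ∕ l.39620 (B) «entry 3 := `ΔG`, letters Σ-a»; CLAIM-3).  `bears_on: R4∕N15 · K3⁸ SpineGivenEndpointR13SepCoPHV
(stmt-QuantumFields-27366; K3⁷ 20544 aside = lineage)`.  Filed `--kind proof --supports stmt-QuantumFields-27366 --as helper` — COUNT-NEUTRAL.  THEOREMS ONLY (0 `def`,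
0 `sorry`).  Imports BY NAME part XXXVI `…N15SiteCurvedOperatorEntries` (p642830: `curvLapF`, `curvLapC`; through it part XXXIII `curvCube`, dag-n15-e Ω-b `kingGT`∕`kingGT₁`∕`kingGOp₁`,
`idef_conj_eq`, `blockOf_comp_blockOf_eq`, Ω-a `castT`∕`hasMaj_conjEquiv`∕`hasMaj_pullEquiv_comp`, Σ-a `kingLapOp`∕`kingFullProp_uniform_layer`, this seat's part VII
`hasMaj_ofBlocks_of_massLimit`∕`continuousAt_kingGOp_mass`, dag-n15-c `tensorId`∕`hasMaj_tensorId`∕`idef_tensorId`); nothing in the tree is modified.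

WHY.  Entry 3 of part XXXVI's operator layer is `𝔇(Δ′X′, ΔX̄)` for the FLAT Laplacian of the dressed propagator; by (3.65) `ΔX = ΔG + (ΔG)·V̂X̂` (n15-b B3 `bgDerivedV`), so its row needs the
UNDRESSED Laplacian letters — fine rows of `N′²Δ′G′ ⊗ 1` and the two-grid defect `𝔇(N′²Δ′G′ ⊗ 1, N²ΔG ⊗ 1)` — on part XXXIII's carriers (nested fine torus, colour lift) at the site
layer's mass `m² = 0`.  dag-n15-e's Σ-a `kingFullProp_uniform_layer` has both for King's `kingLapOp` on the massive range `0 < m² ≤ m₀²` through King's pairing `underPtN`; THIS FILE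
(i) identifies part XXXVI's `curvLapC ∘ (G ⊗ 1)`, `curvLapF ∘ (G′ ⊗ 1)` with `kingLapOp ⊗ 1` and its cast-conjugate (§1), (ii) closes the mass range at `0` by part VII's limit device
(§2–§3), (iii) reads the two letters on the coloured nested carriers (§4) — the sequel part XXXIX knits them with dag-n15-w2's species letters into the entry-3 row.

CONTENTS.  §1 `curvLapC_comp_kingGT` (`curvLapC ∘ (A₀⁻¹ ⊗ 1) = (N²ΔA₀⁻¹) ⊗ 1`), `curvLapF_comp_kingGT₁` (fine, through the cast); §2 `continuousAt_kingLapOp_mass`; §3 ★ `kingLap_layer_massRange`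
(Σ-a's fine Laplacian rows and Laplacian defect at `n = 1` on `0 ≤ m² ≤ m₀²`); §4 ★★ `curvLap_letters_massRange` (the same two letters for `curvLapF ∘ (G′₁ ⊗ 1)`, `curvLapC ∘ (G′ ⊗ 1)`
on part XXXIII's carriers: ONE `(β_Δ, δ_Δ, m_Δ)`, rows `β_Δe^{−δ_Δ|y−y′|_T}`, defect `m_Δ(L^K)^{−γ∕2}e^{−δ_Δ|y−y′|_T}`, every `0 ≤ γ < 1`); §5 ★ `hasMaj_idef_derived_of_letters` (GENERIC,
rate currency: the η-defect of a derived entry `Y = D₃ + (D₃∘V̂)∘X̂` from seven exponential-rate letters — Leibniz twice + [B11] `hasMaj_comp_exp`; n15-b B3's shape with the pair's own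
defect ∕ rows as inputs — the sequel part XXXIX feeds it).

HONEST FRAMING ∕ LIMITS.  Count-neutral bookkeeping (identities + a limit) over dag-n15-e's LANDED King-model letters; no new analytic estimate.  King's `A = 0` MODEL propagator (periodic
b.c., `U ≡ 1` averaging), ONE blocking step, FLAT Laplacian; NOT Bałaban's `Δ_U G(U)`; nothing of [B9] asserted ((3.42) p. 397 = SHAPE; [King1986] (2.17) p. 653, Prop. 3.8 (3.71)
p. 664, (4.1)–(4.5) p. 670 = the typed model; [Balaban1984PropagatorsI] p. 25 = the massless `G′`).  NE2⁺ NOT PRINTED ∕ NOT proved for d = 4; **N15 is NOT discharged**; K3⁸ OPEN,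
not claimed, skeleton v6 untouched; counts of record UNMOVED (typed 28∕28 · discharged 5∕27, A 5∕28); one finite four-torus programme at fixed `ε` — NOT ℝ⁴, NOT infinite volume,
NOT OS, NOT a mass gap, NOT Clay; R4 closes the conditional finite-𝕋⁴ rung `BalabanLadder.UV` only.  Restate-immune (no Theses import).
-/

set_option autoImplicit false

noncomputable section
open scoped BigOperators Matrix Matrix.Norms.Frobenius Topology

namespace Summit.QuantumFields.YangMills.BalabanUVNodes.N15.SiteLayerBg

open Real Finset NormedSpace Filter
open Literature.MathematicalPhysics.QuantumFieldTheory.Balaban1983to89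
open Literature.MathematicalPhysics.QuantumFieldTheory.Balaban1983to89.B11SectG (BlockNorm HasMaj RowSum hasMaj_comp_exp)
open Literature.MathematicalPhysics.QuantumFieldTheory.Balaban1983to89.B6RandomWalk (Triangle254)
open Literature.MathematicalPhysics.QuantumFieldTheory.Balaban1983to89.T4EtaRateDefect (idef idef_apply idef_comp idef_add)
open Literature.MathematicalPhysics.QuantumFieldTheory.Balaban1983to89.T4EtaRateCoeffDefect (pull pull_apply)
open Literature.MathematicalPhysics.QuantumFieldTheory.Balaban1983to89.B5Prop11Plancherel (Tor fine unitVec)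
open Literature.MathematicalPhysics.QuantumFieldTheory.King1986 (aK aK_pos)
open Literature.MathematicalPhysics.QuantumFieldTheory.King1986.Torus (fineOp blockOf tdistT tdistT_nonneg)
open Summit.QuantumFields.YangMills.BalabanUVNodes.N15.VectorPiece (unitTorusGeoS tensorId tensorId_apply hasMaj_tensorId idef_tensorId)
open Summit.QuantumFields.YangMills.BalabanUVNodes.N15.MatrixSpecies (liftMap liftBlk liftEquiv liftEquiv_apply liftEquiv_symm_apply)
open Summit.QuantumFields.YangMills.BalabanUVNodes.N15.BackgroundLayer (fgrad bgrad fgrad_apply bgrad_apply liftPair blkPair)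
open Summit.QuantumFields.YangMills.BalabanUVNodes.N15.BackgroundModel (kappa_ofBlocks)
open Summit.QuantumFields.YangMills.BalabanUVNodes.N15.CurvedSpecies (torStep torStep_symm_apply)
open Summit.QuantumFields.YangMills.BalabanUVNodes.N15KingModelRung (KingVolIndex)
open Summit.QuantumFields.YangMills.BalabanUVNodes.N15KingModelRung.Curved

variable {d : ℕ} (L : ℕ) [NeZero L]
variable (κ : Type) [Fintype κ] [DecidableEq κ] (a : ℝ)

/-! ## §1 The dictionary: part XXXVI's lifted Laplacians after King's propagator `⊗ 1` are dag-n15-e's `kingLapOp ⊗ 1` -/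

section Dictionary

omit [Fintype κ] [DecidableEq κ] in
/-- COARSE: `(N²Δ ⊗ 1) ∘ (A₀⁻¹ ⊗ 1) = (N²ΔA₀⁻¹) ⊗ 1` (`N = L^K`). [cite: King1986, (4.1)–(4.5) p.670; Balaban1985BackgroundPropagators, (3.42) p.397 (fourth entry, shape)] -/
theorem curvLapC_comp_kingGT (i : KingVolIndex d) (msq : ℝ) :
    curvLapC L κ i ∘ₗ kingGT L a msq i.K (curvCube L i) κ = tensorId κ (kingLapOp L a msq i.K (L ^ i.K) (curvCube L i)) := by
  refine LinearMap.ext fun f => funext fun p => ?_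
  simp only [curvLapC, kingGT, LinearMap.comp_apply, LinearMap.smul_apply, LinearMap.coe_sum, Finset.sum_apply, LinearMap.sub_apply, Pi.smul_apply,
    Pi.sub_apply, smul_eq_mul, fgrad_apply, bgrad_apply, liftEquiv_apply, liftEquiv_symm_apply, tensorId_apply, torStep, kingTorusLine_unitVec_eq, Equiv.coe_addRight,
    Equiv.addRight_symm, kingGOp_apply, kingLapOp_apply, ← sub_eq_add_neg]
  push_cast
  rw [Finset.mul_sum, Finset.mul_sum]
  exact Finset.sum_congr rfl fun μ _ => by ring

omit [Fintype κ] [DecidableEq κ] in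
/-- FINE, THROUGH THE CAST: `(N′²Δ′ ⊗ 1) ∘ (G′₁ ⊗ 1) = (cast ∘ N′²Δ′A₀′⁻¹ ∘ cast⁻¹) ⊗ 1` (`N′ = L·L^K`; the cast is a translation homomorphism). [cite: King1986, (2.20) p.654, (4.1)–(4.5) p.670] -/
theorem curvLapF_comp_kingGT₁ (i : KingVolIndex d) (msq : ℝ) :
    curvLapF L κ i ∘ₗ kingGT₁ L a msq i.K (curvCube L i) κ =
      tensorId κ (pull ⇑(castT L i.K (curvCube L i)) ∘ₗ kingLapOp L a msq (i.K + 1) (L ^ 1 * L ^ i.K) (curvCube L i) ∘ₗ pull ⇑(castT L i.K (curvCube L i)).symm) := by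
  refine LinearMap.ext fun f => funext fun p => ?_
  simp only [curvLapF, kingGT₁, kingGOp₁, LinearMap.comp_apply, LinearMap.smul_apply, LinearMap.coe_sum, Finset.sum_apply, LinearMap.sub_apply, Pi.smul_apply,
    Pi.sub_apply, smul_eq_mul, fgrad_apply, bgrad_apply, liftEquiv_apply, liftEquiv_symm_apply, tensorId_apply, torStep, kingTorusLine_unitVec_eq,
    Equiv.coe_addRight, Equiv.addRight_symm, pull_apply, kingGOp_apply, kingLapOp_apply, castT_add_unitVec, castT_sub_unitVec, ← sub_eq_add_neg]
  push_cast
  rw [Finset.mul_sum, Finset.mul_sum]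
  exact Finset.sum_congr rfl fun μ _ => by ring

end Dictionary

/-! ## §2 Continuity of the Laplacian entry in the mass at `m² = 0` -/

section Continuity

variable (M : Fin (d + 1) → ℕ) [∀ μ, NeZero (M μ)] (N : ℕ) [NeZero N]

omit [NeZero L] in
/-- `m² ↦ (N²ΔA₀(a_K, N², m²)⁻¹λ)(x)` is continuous at `m² = 0` (a finite sum of values of `A₀⁻¹λ`, each continuous by part VII). [cite: King1986, (4.1)–(4.5) p.670; Balaban1984PropagatorsI, p.25] -/
theorem continuousAt_kingLapOp_mass (hL : 1 < L) (ha : 0 < a) {K : ℕ} (hK : 1 ≤ K) (lam : Tor (fine N M) → ℝ) (x : Tor (fine N M)) :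
    ContinuousAt (fun m2 : ℝ => kingLapOp L a m2 K N M lam x) 0 := by
  have hG : ∀ z : Tor (fine N M), ContinuousAt (fun m2 : ℝ => kingGOp L a m2 K N M lam z) 0 := fun z => continuousAt_kingGOp_mass M N L hL ha hK lam z
  simp only [kingLapOp_apply, ← kingGOp_apply]
  refine continuousAt_const.mul (tendsto_finsetSum _ fun μ _ => ?_)
  exact ((hG _).add (hG _)).sub (continuousAt_const.mul (hG _))

end Continuity

/-! ## §3 ★ dag-n15-e's Laplacian letters at `n = 1` on the closed mass range -/

section Scalar

/-- ★ **THE FINE LAPLACIAN ROWS AND THE LAPLACIAN DEFECT ON `0 ≤ m² ≤ m₀²`** (Σ-a `kingFullProp_uniform_layer`, conjuncts 5 and 9, at `n = 1` on `(0, m₀² + 1]`; at `m² = 0`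
their limit by part VII `hasMaj_ofBlocks_of_massLimit` + §2): for odd `L ≥ 3`, `a > 0`, `m₀² ≥ 0`, `0 ≤ γ < 1` there are `β, δ, m₀ > 0` with, for every `K ≥ 1`, cube `2L^e`,
mass `0 ≤ m² ≤ m₀²`, `Msz`: `N′²Δ′A₀′⁻¹ ≤ βe^{−δ|y−y′|_T}` (fine blocks → fine blocks) and `𝔇(N′²Δ′A₀′⁻¹, N²ΔA₀⁻¹) ≤ m₀(L^K)^{−γ∕2}e^{−δ|y−y′|_T}` through King's pairing.
[cite: King1986, (2.17) p.653, Prop. 3.8 (3.71) p.664, (4.1)–(4.5) p.670; Balaban1985BackgroundPropagators, Thm 3.1 (3.42) p.397 (fourth entry, shape); Balaban1984PropagatorsI, p.25 (massless `G′`)] -/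
theorem kingLap_layer_massRange (hLodd : Odd L) (hL : 2 ≤ L) (ha : 0 < a) {m0sq : ℝ} (hm0 : 0 ≤ m0sq) {γ : ℝ} (hγ0 : 0 ≤ γ) (hγ1 : γ < 1) :
    ∃ β δ m₀ : ℝ, 0 < β ∧ 0 < δ ∧ 0 < m₀ ∧ ∀ (K : ℕ), 1 ≤ K → ∀ (e : ℕ) (M : Fin (d + 1) → ℕ) [∀ μ, NeZero (M μ)], (∀ μ, M μ = 2 * L ^ e) →
      ∀ (msq : ℝ), 0 ≤ msq → msq ≤ m0sq → ∀ (Msz : ℝ),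
      HasMaj (BlockNorm.ofBlocks (unitTorusGeoS L K M Msz) (blockOf (L ^ K) M ∘ underPtN L K 1 M))
          (BlockNorm.ofBlocks (unitTorusGeoS L K M Msz) (blockOf (L ^ K) M ∘ underPtN L K 1 M))
          (kingLapOp L a msq (K + 1) (L ^ 1 * L ^ K) M) (fun y y' => β * Real.exp (-(δ * tdistT M y y')))
      ∧ HasMaj (BlockNorm.ofBlocks (unitTorusGeoS L K M Msz) (blockOf (L ^ K) M))
          (BlockNorm.ofBlocks (unitTorusGeoS L K M Msz) (blockOf (L ^ K) M ∘ underPtN L K 1 M))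
          (idef (pull (underPtN L K 1 M)) (pull (underPtN L K 1 M)) (kingLapOp L a msq (K + 1) (L ^ 1 * L ^ K) M) (kingLapOp L a msq K (L ^ K) M))
          (fun y y' => m₀ * ((L : ℝ) ^ K) ^ (-(γ / 2)) * Real.exp (-(δ * tdistT M y y'))) := by
  obtain ⟨β, δ, m₀, hβ, hδ, hm₀, H⟩ := kingFullProp_uniform_layer (d := d) L hLodd hL ha (show (0 : ℝ) ≤ m0sq + 1 by linarith) hγ0 hγ1
  refine ⟨β, δ, m₀, hβ, hδ, hm₀, fun K hK e M _ hM msq hmsq hcap Msz => ?_⟩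
  rcases hmsq.lt_or_eq with hpos | h0
  · obtain ⟨-, -, -, -, h5, -, -, -, h9⟩ := H K hK 1 le_rfl e M hM msq hpos (by linarith) Msz 0
    exact ⟨h5, h9⟩
  subst h0
  have hL1 : 1 < L := by omega
  have hm1 : (0 : ℝ) < m0sq + 1 := by linarith
  have hK1 : 1 ≤ K + 1 := Nat.le_add_left 1 K
  have HK := fun (m2 : ℝ) (hm2 : 0 < m2) (hcap2 : m2 ≤ m0sq + 1) => H K hK 1 le_rfl e M hM m2 hm2 hcap2 Msz 0
  refine ⟨?_, ?_⟩
  · exact hasMaj_ofBlocks_of_massLimit (g := unitTorusGeoS L K M Msz) (blockOf (L ^ K) M ∘ underPtN L K 1 M) (blockOf (L ^ K) M ∘ underPtN L K 1 M)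
      (fun m2 => kingLapOp L a m2 (K + 1) (L ^ 1 * L ^ K) M) _ hm1
      (fun lam x => continuousAt_kingLapOp_mass L a M (L ^ 1 * L ^ K) hL1 ha hK1 lam x) (fun m2 hm2 hcap2 => (HK m2 hm2 hcap2).2.2.2.2.1)
  · refine hasMaj_ofBlocks_of_massLimit (g := unitTorusGeoS L K M Msz) (blockOf (L ^ K) M) (blockOf (L ^ K) M ∘ underPtN L K 1 M)
      (fun m2 => idef (pull (underPtN L K 1 M)) (pull (underPtN L K 1 M)) (kingLapOp L a m2 (K + 1) (L ^ 1 * L ^ K) M) (kingLapOp L a m2 K (L ^ K) M)) _ hm1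
      (fun lam x' => ?_) (fun m2 hm2 hcap2 => (HK m2 hm2 hcap2).2.2.2.2.2.2.2.2)
    simp only [idef_apply, Pi.sub_apply, pull_apply]
    exact (continuousAt_kingLapOp_mass L a M (L ^ 1 * L ^ K) hL1 ha hK1 _ x').sub (continuousAt_kingLapOp_mass L a M (L ^ K) hL1 ha hK lam _)

end Scalar

/-! ## §4 ★★ The two Laplacian letters on part XXXIII's coloured carriers -/

section Coloured

omit [DecidableEq κ] in
/-- ★★ **THE LAPLACIAN LETTERS OF THE CURVED KING FAMILY** (undressed half of part XXXVI's entry 3): for odd `L ≥ 3`, `a > 0`, `m₀² ≥ 0`, `0 ≤ γ < 1` there are `β_Δ, δ_Δ, m_Δ > 0` such that for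
every index `i` and every mass `0 ≤ m² ≤ m₀²` (the site layer's `m² = 0` included): the fine Laplacian piece `curvLapF ∘ (G′₁ ⊗ 1) = (N′²Δ′G′) ⊗ 1` has rows `β_Δe^{−δ_Δ|y−y′|_T}` on the
coloured nested fine cubes, and the two-grid defect `𝔇(curvLapF ∘ (G′₁ ⊗ 1), curvLapC ∘ (G′ ⊗ 1))` through the colour-lifted one-step block map is `≤ m_Δ(L^K)^{−γ∕2}e^{−δ_Δ|y−y′|_T}` — §3
through §1's dictionary, dag-n15-c's lift (`hasMaj_tensorId`, `idef_tensorId`) and dag-n15-e's cast (`hasMaj_conjEquiv`, `idef_conj_eq`, `hasMaj_pullEquiv_comp`).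
[cite: King1986, (2.17) p.653, (2.20) p.654, Prop. 3.8 (3.71) p.664, p.664 (pairing); Balaban1985BackgroundPropagators, Thm 3.1 (3.42) p.397 (fourth entry, shape)] -/
theorem curvLap_letters_massRange (hLodd : Odd L) (hL : 2 ≤ L) (ha : 0 < a) {m0sq : ℝ} (hm0 : 0 ≤ m0sq) {γ : ℝ} (hγ0 : 0 ≤ γ) (hγ1 : γ < 1) :
    ∃ β δ m₀ : ℝ, 0 < β ∧ 0 < δ ∧ 0 < m₀ ∧ ∀ (i : KingVolIndex d) (msq : ℝ), 0 ≤ msq → msq ≤ m0sq →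
      HasMaj (BlockNorm.ofBlocks (unitTorusGeoS L i.K (curvCube L i) i.Msz) (liftBlk (blockOf (L ^ i.K) (curvCube L i) ∘ blockOf L (fine (L ^ i.K) (curvCube L i))) κ))
          (BlockNorm.ofBlocks (unitTorusGeoS L i.K (curvCube L i) i.Msz) (liftBlk (blockOf (L ^ i.K) (curvCube L i) ∘ blockOf L (fine (L ^ i.K) (curvCube L i))) κ))
          (curvLapF L κ i ∘ₗ kingGT₁ L a msq i.K (curvCube L i) κ) (fun y y' => β * Real.exp (-(δ * tdistT (curvCube L i) y y')))
      ∧ HasMaj (BlockNorm.ofBlocks (unitTorusGeoS L i.K (curvCube L i) i.Msz) (liftBlk (blockOf (L ^ i.K) (curvCube L i)) κ))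
          (BlockNorm.ofBlocks (unitTorusGeoS L i.K (curvCube L i) i.Msz) (liftBlk (blockOf (L ^ i.K) (curvCube L i) ∘ blockOf L (fine (L ^ i.K) (curvCube L i))) κ))
          (idef (pull (liftMap (blockOf L (fine (L ^ i.K) (curvCube L i))) κ)) (pull (liftMap (blockOf L (fine (L ^ i.K) (curvCube L i))) κ))
            (curvLapF L κ i ∘ₗ kingGT₁ L a msq i.K (curvCube L i) κ) (curvLapC L κ i ∘ₗ kingGT L a msq i.K (curvCube L i) κ))
          (fun y y' => m₀ * ((L : ℝ) ^ i.K) ^ (-(γ / 2)) * Real.exp (-(δ * tdistT (curvCube L i) y y'))) := by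
  obtain ⟨β, δ, m₀, hβ, hδ, hm₀, H⟩ := kingLap_layer_massRange (d := d) L a hLodd hL ha hm0 hγ0 hγ1
  refine ⟨β, δ, m₀, hβ, hδ, hm₀, fun i msq hmsq hcap => ?_⟩
  have hLr : (0 : ℝ) ≤ (L : ℝ) := Nat.cast_nonneg _
  obtain ⟨h5, h9⟩ := H i.K i.one_le_K i.m (curvCube L i) (fun _ => rfl) msq hmsq hcap i.Msz
  have maj0 : ∀ y y' : Tor (curvCube L i), 0 ≤ β * Real.exp (-(δ * tdistT (curvCube L i) y y')) := fun _ _ => by positivity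
  have majm : ∀ y y' : Tor (curvCube L i), 0 ≤ m₀ * ((L : ℝ) ^ i.K) ^ (-(γ / 2)) * Real.exp (-(δ * tdistT (curvCube L i) y y')) :=
    fun _ _ => mul_nonneg (mul_nonneg hm₀.le (Real.rpow_nonneg (pow_nonneg hLr _) _)) (Real.exp_nonneg _)
  refine ⟨?_, ?_⟩
  · rw [curvLapF_comp_kingGT₁, blockOf_comp_blockOf_eq]
    exact hasMaj_tensorId κ maj0 (hasMaj_conjEquiv _ _ (castT L i.K (curvCube L i)) maj0 h5)
  · rw [curvLapF_comp_kingGT₁, curvLapC_comp_kingGT, idef_tensorId]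
    refine hasMaj_tensorId κ majm ?_
    rw [idef_conj_eq, blockOf_comp_blockOf_eq]
    exact hasMaj_pullEquiv_comp _ (castT L i.K (curvCube L i)) majm h9

end Coloured

/-! ## §5 ★ The derived-entry knit in the rate currency (the slot the letters of §4 and the sequel's species letters fill) -/

section Knit

variable {g : B6.Geometry} {X X' J : Type} [Fintype X] [Fintype X'] [Fintype J] (blk : X → g.Site) (blkf : X' → g.Site) (pr : X' → X)
  {D₃ : (X → ℝ) →ₗ[ℝ] (X → ℝ)} {D₃' : (X' → ℝ) →ₗ[ℝ] (X' → ℝ)} {V : (X × Option J → ℝ) →ₗ[ℝ] (X → ℝ)} {V' : (X' × Option J → ℝ) →ₗ[ℝ] (X' → ℝ)}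
  {Xc : (X → ℝ) →ₗ[ℝ] (X × Option J → ℝ)} {Xf : (X' → ℝ) →ₗ[ℝ] (X' × Option J → ℝ)}

omit [NeZero L] in
/-- ★ **THE η-DEFECT OF A DERIVED ENTRY `Y = D₃ + (D₃∘V̂)∘X̂` FROM LETTERS, RATE CURRENCY** (n15-b B3 `hasMaj_idef_bgDerivedV`'s shape with the dressed pair's own defect and rows as
INPUTS and exponential-rate majorants throughout — the slot dag-n15-w2 g5's species letters fill): a [B6] carrier ((2.54), row sums `c_r ≥ 0` at rate `σ ≥ 0` with `4σ ≤ δ`); coarse ∕ fine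
lattices blocked by `blk`, `blkf`, paired by `pr`; fine derived piece `D₃′ ≤ βe^{−δd}` and the defect `𝔇(D₃′, D₃) ≤ m_De^{−δd}`; perturbations `V̂′, V̂ ≤ Re^{−δd}` and their defect
`𝔇(V̂′, V̂) ≤ oe^{−δd}`; the pairs' defect `𝔇(X̂′, X̂) ≤ m_Xe^{−δd}` and the coarse pair `X̂ ≤ b_Xe^{−(δ−σ)d}`.  CONCLUSION: `𝔇(D₃′ + (D₃′V̂′)X̂′, D₃ + (D₃V̂)X̂) ≤
(m_D + βRc_r·m_Xc_r + (βoc_r + m_DRc_r)·b_Xc_r)·e^{−(δ−2σ)d}` (Leibniz twice, (2.52)–(2.56)). [cite: Balaban1985BackgroundPropagators, (3.42) p.397 (fourth entry) + (3.63)–(3.65) pp.402–403 (mechanism); Balaban1984PropagatorsII, (2.52)–(2.56) pp.232–233, Lemma 2.1 (2.61) p.234] -/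
theorem hasMaj_idef_derived_of_letters (htri : Triangle254 g) (hd : ∀ a b : g.Site, 0 ≤ g.dist a b) {σ cr : ℝ} (hcr : 0 ≤ cr) (hrow : RowSum g σ cr)
    {δ β R o mX mD bX : ℝ} (hσ : 0 ≤ σ) (hσδ : 4 * σ ≤ δ) (hβ : 0 ≤ β) (hR : 0 ≤ R) (ho : 0 ≤ o) (hmX : 0 ≤ mX) (hmD : 0 ≤ mD) (hbX : 0 ≤ bX)
    (hD' : HasMaj (BlockNorm.ofBlocks g blkf) (BlockNorm.ofBlocks g blkf) D₃' (fun y y' => β * Real.exp (-(δ * g.dist y y'))))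
    (hDD : HasMaj (BlockNorm.ofBlocks g blk) (BlockNorm.ofBlocks g blkf) (idef (pull pr) (pull pr) D₃' D₃) (fun y y' => mD * Real.exp (-(δ * g.dist y y'))))
    (hV' : HasMaj (BlockNorm.ofBlocks g (blkPair blkf)) (BlockNorm.ofBlocks g blkf) V' (fun y y' => R * Real.exp (-(δ * g.dist y y'))))
    (hV : HasMaj (BlockNorm.ofBlocks g (blkPair blk)) (BlockNorm.ofBlocks g blk) V (fun y y' => R * Real.exp (-(δ * g.dist y y'))))
    (hDV : HasMaj (BlockNorm.ofBlocks g (blkPair blk)) (BlockNorm.ofBlocks g blkf) (idef (pull (liftPair pr)) (pull pr) V' V)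
      (fun y y' => o * Real.exp (-(δ * g.dist y y'))))
    (hDX : HasMaj (BlockNorm.ofBlocks g blk) (BlockNorm.ofBlocks g (blkPair blkf)) (idef (pull pr) (pull (liftPair pr)) Xf Xc)
      (fun y y' => mX * Real.exp (-(δ * g.dist y y'))))
    (hX : HasMaj (BlockNorm.ofBlocks g blk) (BlockNorm.ofBlocks g (blkPair blk)) Xc (fun y y' => bX * Real.exp (-((δ - σ) * g.dist y y')))) :
    HasMaj (BlockNorm.ofBlocks g blk) (BlockNorm.ofBlocks g blkf)
      (idef (pull pr) (pull pr) (D₃' + (D₃' ∘ₗ V') ∘ₗ Xf) (D₃ + (D₃ ∘ₗ V) ∘ₗ Xc))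
      (fun y y' => (mD + β * R * cr * mX * cr + (β * o * cr + mD * R * cr) * bX * cr) * Real.exp (-((δ - 2 * σ) * g.dist y y'))) := by
  -- Leibniz twice: `𝔇(Y′, Y) = 𝔇(D₃′, D₃) + [(D₃′V̂′)𝔇(X̂′, X̂) + (D₃′𝔇(V̂′, V̂) + 𝔇(D₃′, D₃)V̂)X̂]`
  have hexp : idef (pull pr) (pull pr) (D₃' + (D₃' ∘ₗ V') ∘ₗ Xf) (D₃ + (D₃ ∘ₗ V) ∘ₗ Xc) =
      idef (pull pr) (pull pr) D₃' D₃ + ((D₃' ∘ₗ V') ∘ₗ idef (pull pr) (pull (liftPair pr)) Xf Xc +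
        (D₃' ∘ₗ idef (pull (liftPair pr)) (pull pr) V' V + idef (pull pr) (pull pr) D₃' D₃ ∘ₗ V) ∘ₗ Xc) := by
    rw [idef_add, idef_comp (pull pr) (pull (liftPair pr)) (pull pr), idef_comp (pull (liftPair pr)) (pull pr) (pull pr)]
  rw [hexp]
  have hρ1 : 0 ≤ δ - σ := by linarith
  have hρ2 : 0 ≤ δ - 2 * σ := by linarith
  -- term A: `(D₃′V̂′)·𝔇(X̂′, X̂)`
  have hA1 : HasMaj (BlockNorm.ofBlocks g (blkPair blkf)) (BlockNorm.ofBlocks g blkf) (D₃' ∘ₗ V')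
      (fun a b => β * R * cr * Real.exp (-((δ - σ) * g.dist a b))) :=
    (hasMaj_comp_exp htri hd hrow hβ hR hρ1 (by linarith) (by linarith) hD' hV').mono fun a b => by rw [kappa_ofBlocks, one_mul]
  have hA : HasMaj (BlockNorm.ofBlocks g blk) (BlockNorm.ofBlocks g blkf) ((D₃' ∘ₗ V') ∘ₗ idef (pull pr) (pull (liftPair pr)) Xf Xc)
      (fun a b => β * R * cr * mX * cr * Real.exp (-((δ - 2 * σ) * g.dist a b))) :=
    (hasMaj_comp_exp htri hd hrow (mul_nonneg (mul_nonneg hβ hR) hcr) hmX hρ2 (by linarith) (by linarith) hA1 hDX).mono fun a b => by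
      rw [kappa_ofBlocks, one_mul]
  -- terms B + C: `(D₃′𝔇(V̂′, V̂) + 𝔇(D₃′, D₃)V̂)·X̂`
  have hB1 : HasMaj (BlockNorm.ofBlocks g (blkPair blk)) (BlockNorm.ofBlocks g blkf) (D₃' ∘ₗ idef (pull (liftPair pr)) (pull pr) V' V)
      (fun a b => β * o * cr * Real.exp (-((δ - σ) * g.dist a b))) :=
    (hasMaj_comp_exp htri hd hrow hβ ho hρ1 (by linarith) (by linarith) hD' hDV).mono fun a b => by rw [kappa_ofBlocks, one_mul]
  have hC1 : HasMaj (BlockNorm.ofBlocks g (blkPair blk)) (BlockNorm.ofBlocks g blkf) (idef (pull pr) (pull pr) D₃' D₃ ∘ₗ V)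
      (fun a b => mD * R * cr * Real.exp (-((δ - σ) * g.dist a b))) :=
    (hasMaj_comp_exp htri hd hrow hmD hR hρ1 (by linarith) (by linarith) hDD hV).mono fun a b => by rw [kappa_ofBlocks, one_mul]
  have hBC1 : HasMaj (BlockNorm.ofBlocks g (blkPair blk)) (BlockNorm.ofBlocks g blkf)
      (D₃' ∘ₗ idef (pull (liftPair pr)) (pull pr) V' V + idef (pull pr) (pull pr) D₃' D₃ ∘ₗ V)
      (fun a b => (β * o * cr + mD * R * cr) * Real.exp (-((δ - σ) * g.dist a b))) :=
    (hB1.add hC1).mono fun a b => le_of_eq (by ring)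
  have hBC : HasMaj (BlockNorm.ofBlocks g blk) (BlockNorm.ofBlocks g blkf)
      ((D₃' ∘ₗ idef (pull (liftPair pr)) (pull pr) V' V + idef (pull pr) (pull pr) D₃' D₃ ∘ₗ V) ∘ₗ Xc)
      (fun a b => (β * o * cr + mD * R * cr) * bX * cr * Real.exp (-((δ - 2 * σ) * g.dist a b))) :=
    (hasMaj_comp_exp htri hd hrow (by positivity) hbX hρ2 (by linarith) (by linarith) hBC1 hX).mono fun a b => by rw [kappa_ofBlocks, one_mul]
  -- term D: `𝔇(D₃′, D₃)` at the slower rate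
  have hDw : HasMaj (BlockNorm.ofBlocks g blk) (BlockNorm.ofBlocks g blkf) (idef (pull pr) (pull pr) D₃' D₃)
      (fun y y' => mD * Real.exp (-((δ - 2 * σ) * g.dist y y'))) :=
    hDD.mono fun y y' => mul_le_mul_of_nonneg_left (Real.exp_le_exp.mpr (neg_le_neg (mul_le_mul_of_nonneg_right (by linarith) (hd y y')))) hmD
  refine (hDw.add (hA.add hBC)).mono fun y y' => le_of_eq ?_
  ring

end Knit


end Summit.QuantumFields.YangMills.BalabanUVNodes.N15.SiteLayerBg

end
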